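import Mathlib
import Summits.Ventures.PercRepro2.UnionPASepFibre

/-!
# Positive association of the pair `(C_s, C_t)` conditioned on the UNION event
`{s ↮ X} ∪ {t ↮ Y}`, for SEPARATED roots (blind cell PercRepro2, mine-1 g33;
proofs/MINE1-TFGEN.md §7, Theorem (AQ); part 3/3 — the main theorem; parts 1–2: `UnionPASepDefs`,
`UnionPASepFibre`)

Row 2′CON-U's PA half (`(UNION-PA)`, MINE-1.md §42(2)) asks whether the BHK pair law
`Law(C_s, C_t | s ↮ t)` conditioned on the union of two avoidance events,
`U = {C_s ∩ X = ∅} ∪ {C_t ∩ Y = ∅}`, is positively associated in the (Z)-order (increasing in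
`C_s`, decreasing in `C_t`). This file proves it when `s` and `t` lie in different components of the
underlying graph (`¬ Conn ends ⊤ s t`): then `s ↮ t` is automatic, the clusters `C_s`, `C_t` are
independent, and the statement is the abstract union lemma (AQ):

  `E[F(C_s,C_t) 1_U] · E[G(C_s,C_t) 1_U] ≤ E[(FG)(C_s,C_t) 1_U] · P(U)`

for nonnegative bounded functionals `F, G` increasing in the first and decreasing in the second
argument. The proof is the three-step argument of (AQ): explore `C_s = W` (tower identity,
`expect_pair_mul_indicator` with the union indicator in place of `1_{s↮t}`); in the fibre the
cluster of `t` is the plain cluster (separation), and the union weight is `1` on `{W ∩ X = ∅}` and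
`1_{t ↮ Y}` off it — Harris, resp. BHK 1.3 for the `t`-cluster with avoided set `Y`, bound the
fibre product from below; the fibre means `F₀(W) = E[F(W, C_t)]`, `F₁(W) = E[F(W, C_t) 1_{t↮Y}]`
are increasing in `W` with `F₁ ≥ P(t↮Y) F₀`, so `F̃ = P(t↮Y) 1_A F₀ + 1_{A^c} F₁` is an increasing
cluster functional of `C_s`; the `W`-marginal of the conditioned law is the mixture of the plain
cluster law and its `{s↮X}`-conditioned version, whose positive association follows from Harris,
BHK 1.3 (`bhk_induced`) and the negative correlation of a monotone functional with the lower set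
`{s↮X}` (`expect_mul_indicator_le_of_isLowerSet`). Everything is multiplied out (no division):
the mixture inequality is certified by the identity
`P(A)·Br = P(A)²·Cov + Bq + δδ'` and the degenerate cases `P(A) = 0`, `P(t↮Y) = 0` are handled
separately.
-/

namespace Summit.Ventures.PercRepro2

namespace UnionSep

variable {V : Type*} {E : Type*} [Fintype E] [DecidableEq E] [Fintype V] [DecidableEq V]
  {R : Type*} [CommRing R] [LinearOrder R] [IsStrictOrderedRing R]

/-! ## The main theorem -/

section MainTheorem

omit [DecidableEq V] [LinearOrder R] [IsStrictOrderedRing R] in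
/-- The tower identity in its final form: `E[H(C_s,C_t) 1_U] = E[a H₀(H) + (1 - a) H₁(H)](C_s)`. -/
lemma expect_union_eq (p : E → R) (ends : E → Sym2 V) (s t : V) (X Y : Finset V)
    (hsep : ¬ Conn ends allOpen s t) (H : Set V → Set V → R) :
    expect p (fun ω => H (cluster ends ω s) (cluster ends ω t) *
        (unionEvent ends s t X Y).indicator 1 ω) =
      expect p (fun ω => aInd X (cluster ends ω s) * H0 p ends t H (cluster ends ω s) +
        (1 - aInd X (cluster ends ω s)) * H1 p ends t Y H (cluster ends ω s)) := by
  rw [expect_union_mul_indicator p ends s t X Y hsep H]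
  have e : (fun ω => expect p (Phi ends t X Y H (cluster ends ω s))) =
      fun ω => aInd X (cluster ends ω s) * H0 p ends t H (cluster ends ω s) +
        (1 - aInd X (cluster ends ω s)) * H1 p ends t Y H (cluster ends ω s) :=
    funext fun ω => expect_Phi_eq p ends s t X Y hsep H ω
  rw [e]

omit [DecidableEq V] [LinearOrder R] [IsStrictOrderedRing R] in
/-- `P(U) = E[a + (1 - a) P(t↮Y)](C_s)`. -/
lemma prob_union_eq (p : E → R) (ends : E → Sym2 V) (s t : V) (X Y : Finset V)
    (hsep : ¬ Conn ends allOpen s t) :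
    prob p (unionEvent ends s t X Y) =
      expect p (fun ω => aInd X (cluster ends ω s) * 1 +
        (1 - aInd X (cluster ends ω s)) * prob p (avoidAll ends t Y)) := by
  rw [prob_eq_expect_indicator]
  have e0 : (unionEvent ends s t X Y).indicator (1 : Config E → R) =
      fun ω => (fun _ _ : Set V => (1 : R)) (cluster ends ω s) (cluster ends ω t) *
        (unionEvent ends s t X Y).indicator 1 ω := by
    funext ω
    simp
  rw [e0, expect_union_eq p ends s t X Y hsep (fun _ _ => 1)]
  have e1 : ∀ W, H0 p ends t (fun _ _ => (1 : R)) W = 1 := fun W => by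
    simp only [H0]
    exact expect_const p 1
  have e2 : ∀ W, H1 p ends t Y (fun _ _ => (1 : R)) W = prob p (avoidAll ends t Y) := fun W => by
    simp only [H1, one_mul]
    exact expect_aInd_cluster p ends t Y
  simp only [e1, e2]

/-- **(UNION-PA) for separated roots — Theorem (AQ).** If `s` and `t` lie in different components
of the graph, then for nonnegative bounded functionals `F, G` of `(C_s, C_t)`, increasing in `C_s`
and decreasing in `C_t`, and any vertex sets `X, Y`,

  `E[F 1_U] · E[G 1_U] ≤ E[(FG) 1_U] · P(U)`, `U = {s ↮ X} ∪ {t ↮ Y}`: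

the pair `(C_s, V ∖ C_t)` is positively associated conditionally on the union event. -/
theorem union_pa_separated (p : E → R) (hp : IsProbVec p) (ends : E → Sym2 V) (s t : V)
    (hsep : ¬ Conn ends allOpen s t) (X Y : Finset V) {F G : Set V → Set V → R}
    (hF : ∀ ⦃W W' C C' : Set V⦄, W ⊆ W' → C' ⊆ C → F W C ≤ F W' C')
    (hG : ∀ ⦃W W' C C' : Set V⦄, W ⊆ W' → C' ⊆ C → G W C ≤ G W' C')
    (hF0 : ∀ W C, 0 ≤ F W C) (hG0 : ∀ W C, 0 ≤ G W C) {M : R}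
    (hFM : ∀ W C, F W C ≤ M) (hGM : ∀ W C, G W C ≤ M) :
    expect p (fun ω => F (cluster ends ω s) (cluster ends ω t) *
        (unionEvent ends s t X Y).indicator 1 ω) *
      expect p (fun ω => G (cluster ends ω s) (cluster ends ω t) *
        (unionEvent ends s t X Y).indicator 1 ω) ≤
    expect p (fun ω => F (cluster ends ω s) (cluster ends ω t) *
        G (cluster ends ω s) (cluster ends ω t) * (unionEvent ends s t X Y).indicator 1 ω) *
      prob p (unionEvent ends s t X Y) := by
  classical
  -- the product functional and its properties
  set FG : Set V → Set V → R := fun W C => F W C * G W C with hFGdef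
  have hFG : ∀ ⦃W W' C C' : Set V⦄, W ⊆ W' → C' ⊆ C → FG W C ≤ FG W' C' :=
    fun W W' C C' h1 h2 => mul_le_mul (hF h1 h2) (hG h1 h2) (hG0 _ _) (le_trans (hF0 _ _) (hF h1 h2))
  have hFG0 : ∀ W C, 0 ≤ FG W C := fun W C => mul_nonneg (hF0 _ _) (hG0 _ _)
  have hM0 : 0 ≤ M := le_trans (hF0 ∅ ∅) (hFM ∅ ∅)
  have hFGM : ∀ W C, FG W C ≤ M * M := fun W C => mul_le_mul (hFM _ _) (hGM _ _) (hG0 _ _) hM0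
  -- rewrite everything through the tower identity
  have eFG : (fun ω => F (cluster ends ω s) (cluster ends ω t) * G (cluster ends ω s) (cluster ends ω t) *
      (unionEvent ends s t X Y).indicator (1 : Config E → R) ω) =
      fun ω => FG (cluster ends ω s) (cluster ends ω t) * (unionEvent ends s t X Y).indicator 1 ω := rfl
  rw [eFG, expect_union_eq p ends s t X Y hsep F, expect_union_eq p ends s t X Y hsep G,
    expect_union_eq p ends s t X Y hsep FG, prob_union_eq p ends s t X Y hsep]
  set β := prob p (avoidAll ends t Y) with hβdef
  have hβ0 : 0 ≤ β := prob_nonneg hp _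
  have hβ1 : β ≤ 1 := prob_le_one hp _
  set PA := prob p (avoidAll ends s X) with hPAdef
  have hPA0 : 0 ≤ PA := prob_nonneg hp _
  -- abbreviations for the fibre means as functions of `W`
  set F0 := H0 p ends t F with hF0def
  set G0 := H0 p ends t G with hG0def
  set FG0 := H0 p ends t FG with hFG0def
  set F1 := H1 p ends t Y F with hF1def
  set G1 := H1 p ends t Y G with hG1def
  set FG1 := H1 p ends t Y FG with hFG1def
  have hF0m : Monotone F0 := H0_mono p hp ends t hF
  have hG0m : Monotone G0 := H0_mono p hp ends t hG
  have hF0n : ∀ W, 0 ≤ F0 W := H0_nonneg p hp ends t hF0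
  have hG0n : ∀ W, 0 ≤ G0 W := H0_nonneg p hp ends t hG0
  have hmulH0 : ∀ W, F0 W * G0 W ≤ FG0 W := H0_mul_le p hp ends t hF hG
  have hmulH1 : ∀ W, F1 W * G1 W ≤ β * FG1 W := H1_mul_le p hp ends t Y hF hG hFM hGM
  rcases hβ0.eq_or_lt with hβz | hβpos
  · -- `P(t ↮ Y) = 0`: the union event is `{s ↮ X}` up to a null set; BHK 1.3 for `s` closes
    have z1 : ∀ W, F1 W = 0 := H1_eq_zero_of_prob_eq_zero p hp ends t Y hF0 hFM hβz.symm
    have z2 : ∀ W, G1 W = 0 := H1_eq_zero_of_prob_eq_zero p hp ends t Y hG0 hGM hβz.symm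
    have z3 : ∀ W, FG1 W = 0 := H1_eq_zero_of_prob_eq_zero p hp ends t Y hFG0 hFGM hβz.symm
    have e1 : (fun ω => aInd X (cluster ends ω s) * F0 (cluster ends ω s) +
        (1 - aInd X (cluster ends ω s)) * F1 (cluster ends ω s)) =
        fun ω => F0 (cluster ends ω s) * aInd X (cluster ends ω s) := by
      funext ω; rw [z1]; ring
    have e2 : (fun ω => aInd X (cluster ends ω s) * G0 (cluster ends ω s) +
        (1 - aInd X (cluster ends ω s)) * G1 (cluster ends ω s)) =
        fun ω => G0 (cluster ends ω s) * aInd X (cluster ends ω s) := by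
      funext ω; rw [z2]; ring
    have e3 : (fun ω => aInd X (cluster ends ω s) * FG0 (cluster ends ω s) +
        (1 - aInd X (cluster ends ω s)) * FG1 (cluster ends ω s)) =
        fun ω => aInd X (cluster ends ω s) * FG0 (cluster ends ω s) := by
      funext ω; rw [z3]; ring
    have e4 : (fun ω => aInd X (cluster ends ω s) * (1 : R) +
        (1 - aInd X (cluster ends ω s)) * β) = fun ω => aInd X (cluster ends ω s) := by
      funext ω; rw [← hβz]; ring
    rw [e1, e2, e3, e4, expect_aInd_cluster p ends s X]
    have key := bhk_cluster_avoid p hp ends s X hF0m hG0m hF0n hG0n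
    have h2 : expect p (fun ω => F0 (cluster ends ω s) * G0 (cluster ends ω s) *
        aInd X (cluster ends ω s)) ≤
        expect p (fun ω => aInd X (cluster ends ω s) * FG0 (cluster ends ω s)) :=
      expect_mono hp fun ω => by
        have := mul_le_mul_of_nonneg_right (hmulH0 (cluster ends ω s))
          (aInd_nonneg (R := R) X (cluster ends ω s))
        linarith
    calc _ ≤ _ := key
      _ ≤ _ := mul_le_mul_of_nonneg_right h2 hPA0
  · -- `P(t ↮ Y) > 0`: the mixture argument
    set Ft := UnionSep.Ft p ends t X Y F with hFtdef
    set Gt := UnionSep.Ft p ends t X Y G with hGtdef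
    have hFtm : Monotone Ft := Ft_mono p hp ends t X Y hF
    have hGtm : Monotone Gt := Ft_mono p hp ends t X Y hG
    have hFtn : ∀ W, 0 ≤ Ft W := Ft_nonneg p hp ends t X Y hF0
    have hGtn : ∀ W, 0 ≤ Gt W := Ft_nonneg p hp ends t X Y hG0
    have hFGtm : Monotone (fun W => Ft W * Gt W) :=
      fun W W' h => mul_le_mul (hFtm h) (hGtm h) (hGtn W) (hFtn W')
    -- the `W`-level quantities
    set eF := expect p (fun ω => Ft (cluster ends ω s)) with heF
    set eG := expect p (fun ω => Gt (cluster ends ω s)) with heG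
    set eFG := expect p (fun ω => Ft (cluster ends ω s) * Gt (cluster ends ω s)) with heFG
    set aF := expect p (fun ω => Ft (cluster ends ω s) * aInd X (cluster ends ω s)) with haF
    set aG := expect p (fun ω => Gt (cluster ends ω s) * aInd X (cluster ends ω s)) with haG
    set aFG := expect p (fun ω => Ft (cluster ends ω s) * Gt (cluster ends ω s) *
      aInd X (cluster ends ω s)) with haFG
    have hC : eF * eG ≤ eFG := harris_cluster p hp ends s hFtm hGtm
    have hB : aF * aG ≤ aFG * PA := bhk_cluster_avoid p hp ends s X hFtm hGtm hFtn hGtn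
    have hD : aF ≤ eF * PA := expect_mul_aInd_le p hp ends s X hFtm
    have hD' : aG ≤ eG * PA := expect_mul_aInd_le p hp ends s X hGtm
    have hD'' : aFG ≤ eFG * PA := expect_mul_aInd_le p hp ends s X hFGtm
    have h0F : 0 ≤ aF := expect_nonneg hp fun ω => mul_nonneg (hFtn _) (aInd_nonneg _ _)
    have h0G : 0 ≤ aG := expect_nonneg hp fun ω => mul_nonneg (hGtn _) (aInd_nonneg _ _)
    have h0FG : 0 ≤ aFG := expect_nonneg hp fun ω =>
      mul_nonneg (mul_nonneg (hFtn _) (hGtn _)) (aInd_nonneg _ _)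
    have mix := mix_ineq hβ0 (sub_nonneg.2 hβ1) hPA0 hC hB hD hD' hD'' h0F h0G h0FG
    -- pointwise links between `F̃` and the fibre split (cases on `a(W) ∈ {0, 1}`)
    have P1 : ∀ W, β * (aInd X W * F0 W + (1 - aInd X W) * F1 W) =
        β * Ft W + (1 - β) * (Ft W * aInd X W) := by
      intro W
      simp only [hFtdef, UnionSep.Ft]
      by_cases h : ∀ x ∈ X, x ∉ W
      · rw [aInd_eq_one h]; ring
      · rw [aInd_eq_zero h]; ring
    have P1' : ∀ W, β * (aInd X W * G0 W + (1 - aInd X W) * G1 W) =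
        β * Gt W + (1 - β) * (Gt W * aInd X W) := by
      intro W
      simp only [hGtdef, UnionSep.Ft]
      by_cases h : ∀ x ∈ X, x ∉ W
      · rw [aInd_eq_one h]; ring
      · rw [aInd_eq_zero h]; ring
    have P2 : ∀ W, β * (Ft W * Gt W) + (1 - β) * (Ft W * Gt W * aInd X W) ≤
        β * β * (aInd X W * FG0 W + (1 - aInd X W) * FG1 W) := by
      intro W
      simp only [hFtdef, hGtdef, UnionSep.Ft]
      by_cases h : ∀ x ∈ X, x ∉ W
      · rw [aInd_eq_one h]
        have := mul_le_mul_of_nonneg_left (hmulH0 W) (mul_nonneg hβ0 hβ0)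
        nlinarith
      · rw [aInd_eq_zero h]
        have := mul_le_mul_of_nonneg_left (hmulH1 W) hβ0
        nlinarith
    -- the expectations of the three links
    have E1 : β * expect p (fun ω => aInd X (cluster ends ω s) * F0 (cluster ends ω s) +
        (1 - aInd X (cluster ends ω s)) * F1 (cluster ends ω s)) = β * eF + (1 - β) * aF := by
      rw [← expect_const_mul]
      have e : (fun ω => β * (aInd X (cluster ends ω s) * F0 (cluster ends ω s) +
          (1 - aInd X (cluster ends ω s)) * F1 (cluster ends ω s))) =
          (fun ω => β * Ft (cluster ends ω s)) +
            fun ω => (1 - β) * (Ft (cluster ends ω s) * aInd X (cluster ends ω s)) := by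
        funext ω
        simp only [Pi.add_apply]
        exact P1 _
      rw [e, expect_add, expect_const_mul, expect_const_mul]
    have E2 : β * expect p (fun ω => aInd X (cluster ends ω s) * G0 (cluster ends ω s) +
        (1 - aInd X (cluster ends ω s)) * G1 (cluster ends ω s)) = β * eG + (1 - β) * aG := by
      rw [← expect_const_mul]
      have e : (fun ω => β * (aInd X (cluster ends ω s) * G0 (cluster ends ω s) +
          (1 - aInd X (cluster ends ω s)) * G1 (cluster ends ω s))) =
          (fun ω => β * Gt (cluster ends ω s)) +
            fun ω => (1 - β) * (Gt (cluster ends ω s) * aInd X (cluster ends ω s)) := by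
        funext ω
        simp only [Pi.add_apply]
        exact P1' _
      rw [e, expect_add, expect_const_mul, expect_const_mul]
    have E3 : β * eFG + (1 - β) * aFG ≤ β * β * expect p (fun ω => aInd X (cluster ends ω s) *
        FG0 (cluster ends ω s) + (1 - aInd X (cluster ends ω s)) * FG1 (cluster ends ω s)) := by
      have e : β * eFG + (1 - β) * aFG = expect p ((fun ω => β * (Ft (cluster ends ω s) *
          Gt (cluster ends ω s))) + fun ω => (1 - β) * (Ft (cluster ends ω s) * Gt (cluster ends ω s) *
          aInd X (cluster ends ω s))) := by
        rw [expect_add, expect_const_mul, expect_const_mul]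
      have e' : β * β * expect p (fun ω => aInd X (cluster ends ω s) * FG0 (cluster ends ω s) +
          (1 - aInd X (cluster ends ω s)) * FG1 (cluster ends ω s)) =
          expect p (fun ω => β * β * (aInd X (cluster ends ω s) * FG0 (cluster ends ω s) +
            (1 - aInd X (cluster ends ω s)) * FG1 (cluster ends ω s))) :=
        (expect_const_mul p (β * β) _).symm
      rw [e, e']
      exact expect_mono hp fun ω => by simpa only [Pi.add_apply] using P2 (cluster ends ω s)
    have E4 : expect p (fun ω => aInd X (cluster ends ω s) * 1 +
        (1 - aInd X (cluster ends ω s)) * β) = β + (1 - β) * PA := by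
      have e : (fun ω => aInd X (cluster ends ω s) * 1 + (1 - aInd X (cluster ends ω s)) * β) =
          (fun _ => β) + fun ω => (1 - β) * aInd X (cluster ends ω s) := by
        funext ω
        simp only [Pi.add_apply]
        ring
      rw [e, expect_add, expect_const, expect_const_mul, expect_aInd_cluster p ends s X]
    -- assemble: `β² · (goal LHS) ≤ β² · (goal RHS)`
    rw [E4]
    set eφ := expect p (fun ω => aInd X (cluster ends ω s) * F0 (cluster ends ω s) +
      (1 - aInd X (cluster ends ω s)) * F1 (cluster ends ω s)) with heφ
    set eψ := expect p (fun ω => aInd X (cluster ends ω s) * G0 (cluster ends ω s) +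
      (1 - aInd X (cluster ends ω s)) * G1 (cluster ends ω s)) with heψ
    set eχ := expect p (fun ω => aInd X (cluster ends ω s) * FG0 (cluster ends ω s) +
      (1 - aInd X (cluster ends ω s)) * FG1 (cluster ends ω s)) with heχ
    have hec : 0 ≤ β + (1 - β) * PA := by
      have := mul_nonneg (sub_nonneg.2 hβ1) hPA0
      linarith
    have step : (β * eφ) * (β * eψ) ≤ (β * β * eχ) * (β + (1 - β) * PA) := by
      rw [E1, E2]
      calc (β * eF + (1 - β) * aF) * (β * eG + (1 - β) * aG)
          ≤ (β * eFG + (1 - β) * aFG) * (β + (1 - β) * PA) := mix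
        _ ≤ (β * β * eχ) * (β + (1 - β) * PA) := mul_le_mul_of_nonneg_right E3 hec
    have hβ2 : 0 < β * β := mul_pos hβpos hβpos
    have : β * β * (eφ * eψ) ≤ β * β * (eχ * (β + (1 - β) * PA)) := by
      have e1 : (β * eφ) * (β * eψ) = β * β * (eφ * eψ) := by ring
      have e2 : (β * β * eχ) * (β + (1 - β) * PA) = β * β * (eχ * (β + (1 - β) * PA)) := by ring
      rw [e1, e2] at step
      exact step
    exact le_of_mul_le_mul_left this hβ2

end MainTheorem

end UnionSep

end Summit.Ventures.PercRepro2
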